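import Literature.Analysis.OperatorTheory.TwistedKernelFluxSectors
import HarnessLib

/-!
# The trivial flux sector from above, and purity from vacuum dominance (abstract bounds for census row 43)

HELPER toward stub **T1** `TwistedSlabAnchor` of LINE `twisted-slab-continuity` (crux `IRcof`, stmt-QuantumFields-26930, census
row 43; LEAD prover ym-ir-line-tsc-p1; `--supports` the crux, `--as helper`; part 1 of 2, part 2 = `BalabanLadderIRTwistedSlabOneBox`).
Model-free: no Yang–Mills object appears here.

* §A `re_fluxSector_zero_le` — the companion, for the TRIVIAL character, of lit-4's
  `Literature.Analysis.OperatorTheory.re_fluxSector_le_pow_mul` (p611637 ∕ `TwistedKernelFluxSectors`): for a positive symmetric bounded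
  kernel invariant under a finite abelian group of measure-preserving twists, eigenbasis `A bᵢ = λᵢ bᵢ`, `0 ≤ λᵢ`, Perron–Frobenius top
  index `i₀` and every sub-dominant eigenvalue `≤ Λ`: `z_0(M+2) ≤ λ_{i₀}^M·λ_{i₀}² + Λ^M·(z_0(2) − λ_{i₀}²)` — the flux-free sector is the
  vacuum plus `Λ`-propagated excitations (lower companion: `le_re_fluxSector_zero`).
* §B `defect_le_two_mul_of_sandwich` — PURITY FROM VACUUM DOMINANCE (pure algebra): `a² ≤ P₂`, `a ≤ P ≤ a·(1 + S)`, `0 < a`, `0 ≤ S`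
  ⇒ `1 − P₂/P² ≤ 2S`.

HONEST FRAMING: transfer-operator bookkeeping and real arithmetic; nothing here bears on `IRcof`, `IR`, or the Yang–Mills mass gap
(Clay: NOT proved); R4 closes only the conditional finite-𝕋⁴ rung `BalabanLadder.UV`.  No `sorry`, no definitions, standard axioms.

References: G. 't Hooft, Nucl. Phys. B 153 (1979) 141, §5 (5.1)–(5.4); M. Reed, B. Simon IV (1978) Thm XIII.43–44.
-/

set_option autoImplicit false

noncomputable section

open MeasureTheory Filter Function Finset
open scoped BigOperators ENNReal ComplexConjugate
open Literature.Analysis.OperatorTheory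

namespace Summit.QuantumFields.YangMills.Cruxes.IRcof.TwistedSlab

/-! ## §A The trivial flux sector from above: vacuum plus `Λ`-propagated excitations (abstract kernel level) -/

section Kernel

variable {X : Type*} [MeasurableSpace X] {μ : Measure X} [IsFiniteMeasure μ]
  {K : X → X → ℝ} {C : ℝ} {A : Lp ℝ 2 μ →L[ℝ] Lp ℝ 2 μ} {ι : Type*}
  {b : HilbertBasis ι ℝ (Lp ℝ 2 μ)} {lam : ι → ℝ}
  {Γ : Type*} [AddCommGroup Γ] [Fintype Γ] {T : Γ → X → X}

/-- **The flux-free sector is the vacuum plus `Λ`-propagated excitations.**  In the setting of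
`Literature.Analysis.OperatorTheory.re_fluxSector_le_pow_mul` (positive symmetric bounded kernel `K`, invariant under a finite abelian
group of measure-preserving twists, eigenbasis `A bᵢ = λᵢ bᵢ` with `0 ≤ λᵢ`, Perron–Frobenius top index `i₀`, every sub-dominant
eigenvalue `≤ Λ`): for the TRIVIAL character, `z_0(M+2) ≤ λ_{i₀}^M·λ_{i₀}² + Λ^M·(z_0(2) − λ_{i₀}²)` — the vacuum carries all of its weight
`λ_{i₀}²` in the sector `e = 0` (`fluxCoeff_top`), and every other eigenvector propagates with `λᵢ^M ≤ Λ^M`; companion of the lower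
bound `le_re_fluxSector_zero`. [cite: tHooft1979Flux, §5 (5.3)–(5.4)] [cite: ReedSimonIV1978, Thm XIII.43 and Thm XIII.44] -/
theorem re_fluxSector_zero_le [Countable ι] (hK : StronglyMeasurable (uncurry K)) (hC : ∀ x y, ‖K x y‖ ≤ C)
    (hsymm : ∀ x y, K x y = K y x) (hKpos : ∀ x y, 0 < K x y)
    (hA : ∀ φ : Lp ℝ 2 μ, (A φ : X → ℝ) =ᵐ[μ] fun x => ∫ y, K x y * φ y ∂μ)
    (hb : ∀ i, A (b i) = lam i • b i) (hlam : ∀ i, 0 ≤ lam i) {i₀ : ι} (hi₀ : lam i₀ = ‖A‖)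
    (hlam₀ : lam i₀ ≠ 0) {Λ : ℝ} (hΛ : ∀ i, i ≠ i₀ → lam i ≤ Λ) (hT : ∀ k, MeasurePreserving (T k) μ μ)
    (hT0 : T 0 = id) (hTadd : ∀ k k' x, T (k + k') x = T k (T k' x))
    (hKT : ∀ k x y, K (T k x) (T k y) = K x y) {z : Γ → ℕ → ℝ}
    (hz : ∀ k M, z k (M + 2) =
      ∫ x, ((fun f : X → ℝ => fun w => ∫ y, K w y * f y ∂μ)^[M + 1] (fun y => K y x)) (T k x) ∂μ)
    (M : ℕ) :
    ((Fintype.card Γ : ℂ)⁻¹ * ∑ k, conj ((0 : AddChar Γ ℂ) k) * (z k (M + 2) : ℂ)).re ≤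
      lam i₀ ^ M * lam i₀ ^ 2 +
        Λ ^ M * (((Fintype.card Γ : ℂ)⁻¹ * ∑ k, conj ((0 : AddChar Γ ℂ) k) * (z k 2 : ℂ)).re - lam i₀ ^ 2) := by
  classical
  -- the flux coefficients `qᵢ(0)` (real parts) and the two trace formulas (periods `M + 2` and `2`)
  set q : ι → ℂ := fun i => (Fintype.card Γ : ℂ)⁻¹ * ∑ k, conj ((0 : AddChar Γ ℂ) k) *
    ((∫ x, (∫ w, K (T k x) w * b i w ∂μ) * (∫ w, K x w * b i w ∂μ) ∂μ : ℝ) : ℂ) with hq_def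
  have hM := Complex.hasSum_re (hasSum_fluxSector hK hC hsymm hA hb hT hz 0 M)
  have h0 := Complex.hasSum_re (hasSum_fluxSector hK hC hsymm hA hb hT hz 0 0)
  have hq := fun i : ι => fluxCoeff_nonneg (b := b) hK hC hT hT0 hTadd i (0 : AddChar Γ ℂ)
  have htop := fluxCoeff_top hK hC hsymm hKpos hA hb hT hKT hi₀ hlam₀ (0 : AddChar Γ ℂ)
  rw [if_pos rfl] at htop
  -- real parts of the summands: `λᵢ^M · Re qᵢ`
  have hre : ∀ (M' : ℕ) (i : ι), (((lam i ^ M' : ℝ) : ℂ) * q i).re = lam i ^ M' * (q i).re := fun M' i =>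
    Complex.re_ofReal_mul _ _
  have htop' : (q i₀).re = lam i₀ ^ 2 := by
    show ((Fintype.card Γ : ℂ)⁻¹ * ∑ k, conj ((0 : AddChar Γ ℂ) k) *
      ((∫ x, (∫ w, K (T k x) w * b i₀ w ∂μ) * (∫ w, K x w * b i₀ w ∂μ) ∂μ : ℝ) : ℂ)).re = lam i₀ ^ 2
    rw [htop, Complex.ofReal_re]
  -- pointwise: `λᵢ^M qᵢ ≤ Λ^M qᵢ + [i = i₀]·(λ_{i₀}^M − Λ^M)·λ_{i₀}²`
  have hpt : ∀ i, (((lam i ^ M : ℝ) : ℂ) * q i).re ≤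
      Λ ^ M * (((lam i ^ 0 : ℝ) : ℂ) * q i).re + (if i = i₀ then (lam i₀ ^ M - Λ ^ M) * lam i₀ ^ 2 else 0) := fun i => by
    rw [hre, hre, pow_zero, one_mul]
    by_cases hi : i = i₀
    · subst hi
      rw [if_pos rfl, htop']
      exact le_of_eq (by ring)
    · rw [if_neg hi, add_zero]
      exact mul_le_mul_of_nonneg_right (pow_le_pow_left₀ (hlam i) (hΛ i hi) M) (hq i).1
  have hsum : HasSum (fun i => Λ ^ M * (((lam i ^ 0 : ℝ) : ℂ) * q i).re +
      (if i = i₀ then (lam i₀ ^ M - Λ ^ M) * lam i₀ ^ 2 else 0))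
      (Λ ^ M * ((Fintype.card Γ : ℂ)⁻¹ * ∑ k, conj ((0 : AddChar Γ ℂ) k) * (z k 2 : ℂ)).re +
        (lam i₀ ^ M - Λ ^ M) * lam i₀ ^ 2) :=
    (h0.mul_left (Λ ^ M)).add (hasSum_ite_eq i₀ ((lam i₀ ^ M - Λ ^ M) * lam i₀ ^ 2))
  have hle := hasSum_le hpt hM hsum
  calc ((Fintype.card Γ : ℂ)⁻¹ * ∑ k, conj ((0 : AddChar Γ ℂ) k) * (z k (M + 2) : ℂ)).re
      ≤ Λ ^ M * ((Fintype.card Γ : ℂ)⁻¹ * ∑ k, conj ((0 : AddChar Γ ℂ) k) * (z k 2 : ℂ)).re +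
          (lam i₀ ^ M - Λ ^ M) * lam i₀ ^ 2 := hle
    _ = lam i₀ ^ M * lam i₀ ^ 2 +
          Λ ^ M * (((Fintype.card Γ : ℂ)⁻¹ * ∑ k, conj ((0 : AddChar Γ ℂ) k) * (z k 2 : ℂ)).re - lam i₀ ^ 2) := by
        ring

end Kernel

/-! ## §B Purity from vacuum dominance (pure algebra) -/

/-- **Purity from vacuum dominance.**  If `a² ≤ P₂` (the vacuum propagates for `2t` steps), `P ≤ a·(1 + S)` (at `t` steps the excited
states add at most the relative weight `S ≥ 0`) and `0 < a`, then the period-doubling defect obeys `1 − P₂/P² ≤ 2S`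
(`1/(1+S)² ≥ 1 − 2S`). [folklore] -/
theorem defect_le_two_mul_of_sandwich {a P P₂ S : ℝ} (ha : 0 < a) (hS : 0 ≤ S) (hP₂ : a ^ 2 ≤ P₂) (hP : P ≤ a * (1 + S))
    (haP : a ≤ P) : 1 - P₂ / P ^ 2 ≤ 2 * S := by
  have hPpos : 0 < P := lt_of_lt_of_le ha haP
  have hP2 : 0 < P ^ 2 := by positivity
  -- `P² ≤ a²(1+S)² ≤ P₂ (1+S)²`, and `(1+S)² (1 − 2S) ≤ 1`
  have h1 : P ^ 2 ≤ a ^ 2 * (1 + S) ^ 2 := by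
    rw [← mul_pow]; exact pow_le_pow_left₀ hPpos.le hP 2
  have h2 : P ^ 2 * (1 - 2 * S) ≤ P₂ := by
    have h3 : (1 + S) ^ 2 * (1 - 2 * S) ≤ 1 := by nlinarith [sq_nonneg S, mul_nonneg hS (sq_nonneg S)]
    by_cases h12 : 1 - 2 * S ≤ 0
    · exact le_trans (mul_nonpos_of_nonneg_of_nonpos hP2.le h12) (le_trans (sq_nonneg a) hP₂)
    · push Not at h12
      calc P ^ 2 * (1 - 2 * S) ≤ a ^ 2 * (1 + S) ^ 2 * (1 - 2 * S) := mul_le_mul_of_nonneg_right h1 h12.le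
        _ = a ^ 2 * ((1 + S) ^ 2 * (1 - 2 * S)) := by ring
        _ ≤ a ^ 2 * 1 := mul_le_mul_of_nonneg_left h3 (sq_nonneg a)
        _ ≤ P₂ := by rw [mul_one]; exact hP₂
  rw [sub_le_comm, le_div_iff₀ hP2]
  linarith

end Summit.QuantumFields.YangMills.Cruxes.IRcof.TwistedSlab

end
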